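import Summits.BirchSwinnertonDyer.Rank1Residual.P2.PrintCf2SplitBadTwoInstTwoGauge
import Summits.BirchSwinnertonDyer.Rank1Residual.P2.PrintCf2SplitBadTwoReadTwoCutValues
import Literature.NumberTheory.LFunctions.TwoPowerConductorKernel
import HarnessLib

set_option autoImplicit false

/-!
# R219-INST₂-CORE (α) «the `∘ϑ̄`-line instance at `P := P_β`» and the (β)-KEY «`V = L_β + c_β` with the constant keyed»:
# the INST₂ leaves H1 ⊕ H3 ⊕ R221 «EVAL₂» ⊕ S4-REFL assembled (critic J10) and instantiated at the reflection quotient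

Cell `bsd-print-cf2`, typer `bsd-print-cf2-ty2` g45 (literature-prover seat; typer directory `Rank1Residual/P2/`, Theses-free, no
item): port P58 (part 2 of 2) of STUB-PLAN `stub_heegnerIndexLowerAtTwo` (crux `PrintCf2.SplitBadTwoLowerHalfOfFacts`,
stmt-BirchSwinnertonDyer-27851; CRITIC-ROWS-g42 rows 119–121; critic g42 ★★ J10 `inst₂_leaves_assembled` (ll. 2521–2538) and sketch k1-g41
`3c421c26b5d9a924` PART M §D–§F VERBATIM; plus the instantiated REFL-table character sum of k2-g41 §C).  HONEST FRAMING: nothing here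
proves BSD, the crux or the stub; no named fact, no definition besides the gauge constant `gaugeConst`, no `sorry`.  What remains of
R219-INST₂ after this file is witness-specific only (the SEAM on units and the ONE application with `Γ := (ℤ/N)ˣ`).

* §D ★★ `inst₂_leaves_assembled` (J10), ★★ `inst₂_core_alpha`.
* §E (β)-KEY: `evS_subst_thetaBar_reflQuotN`, `gaugeConst`, `norm_one_sub_map_gaugeUnit_lt`, `norm_one_sub_map_evS_reflQuotN_lt`,
  ★ `half_plog_reflQuotN_eq`, ★ `map_subst_thetaBar_reflQuotC_eq_transport`, `transport_reflQuot_value`, ★★ `inst₂_core_alpha_beta`.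
* §F log-branch remark: `reflQuot_mul_reflE`, `reflE_C_mul`, `quot_mul_reflE_rescale`.
* §G ★ `refl_table_charSum_two_pow` (the REFL sum at `Γ = (ℤ/2^{n+1})ˣ`, `γ₀ = 1 + 2^n`, both hypotheses now theorems).

References: [deShalit1987] Ch. I §3, II §4.12–4.14; [Rubin1991] §7; [IrelandRosen1990] Ch. 4 §1 Thm 2′.
-/

noncomputable section

namespace Summit.BirchSwinnertonDyer.Rank1Residual.P2.InstTwoCore

section Core

open ValuativeRel IsLocalRing Field
open Literature.NumberTheory.Transcendental
open Literature.NumberTheory.GaloisRepresentations Literature.NumberTheory.GaloisRepresentations.IsNonarchimedeanLocalField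
  Literature.NumberTheory.GaloisRepresentations.LubinTate Literature.NumberTheory.PAdicHodge
  Literature.NumberTheory.EllipticCurves

variable {F : Type} [Field F] [ValuativeRel F] [TopologicalSpace F] [IsNonarchimedeanLocalField F]

attribute [local instance] ltNormUniformSpace ltNormIsUniformAddGroup rk1 nF nE fintypeResidueField

/-! ### §D  ★★ the INST₂ leaves assembled (critic J10) and R219-INST₂-CORE (α) -/

/-- ★★ J10 «THE INST₂ LEAVES ASSEMBLED» (k2-g41 H1 ⊕ H3 ⊕ k3-g40 R221 ⊕ S4-REFL): for the reflection quotient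
`P ∈ 𝒪_ℂ⟦X⟧` with `P(0) = 1` and `2 ∣ [X^{n+1}]P`, the reading witness `L∘y` EXISTS in `𝒪_ℂ⟦X⟧` and its `θ`-value
at every `z ∈ 𝔪_ℂ` IS `½·plog θ P(z)` — hypothesis-free except the frame (`θ` continuous & integral, `‖2‖_ℂ < 1`).
What remains of R219-INST₂ after this is witness-specific only: the `∘ϑ` line, `V = L_b + c`, SEAM, ONE application. -/
theorem inst₂_leaves_assembled (θ : CompletedAlgClosure F →+* ℂ_[2]) (hθc : Continuous θ)
    (hθ1 : ∀ z : CBall F, ‖θ (z : CompletedAlgClosure F)‖ ≤ 1) (h2 : ‖(2 : CompletedAlgClosure F)‖ < 1)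
    (P : PowerSeries (CBall F)) (hP0 : PowerSeries.constantCoeff P = 1)
    (hP : ∀ n : ℕ, (2 : CBall F) ∣ PowerSeries.coeff (n + 1) P) (z : (maxNilIdealC F).toIdeal) :
    ∃ L y : PowerSeries (CBall F), PowerSeries.constantCoeff y = 0 ∧ P = 1 + PowerSeries.C (2 : CBall F) * y ∧
      θ ((PowerSeries.coeff 0 L : CBall F) : CompletedAlgClosure F) = 0 ∧
      ∑' m : ℕ, PowerSeries.coeff m (PowerSeries.map (θ.comp (CBall F).subtype) (PowerSeries.subst y L)) *
          (θ ((z : CBall F) : CompletedAlgClosure F)) ^ m =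
        (2 : ℂ_[2])⁻¹ * Literature.NumberTheory.Transcendental.PadicExp.plog
          (θ ((evS (maxNilIdealC F) z P : CBall F) : CompletedAlgClosure F)) := by
  obtain ⟨y, hy0, hPy⟩ := ShiftLift.exists_eq_one_add_C_mul (2 : CBall F) P hP0 hP
  obtain ⟨L, hL0, hL⟩ := ShiftLift.exists_Lam2_lift_map h2 θ
  exact ⟨L, y, hy0, hPy, hL0, (ReadTwoCut.read_value_eq_tsum_lamTerm θ hθc L y hy0 hL0 hL z).trans
    (ReadTwoCut.lambda_value_refl_evS θ hθ1 hPy z)⟩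

variable (hq : residueFieldCard F = 2) (h2 : (valuation F).IsUniformizer (((2 : ℕ) : 𝒪[F]) : F)) (u : 𝒪[F]ˣ)
variable (E : IntermediateField F (AlgebraicClosure F)) [FiniteDimensional F E] [Normal F E] [IsGalois F E]
  (hE : E ≤ maxUnramified F) {σ₀ : absoluteGaloisGroup F} (hσ₀ : IsAbsArithFrob σ₀)
variable {ε : (maxUnramifiedCompletion F)ˣ}
  (hε : maxUnramifiedCompletion.galAut F σ₀ (ε : maxUnramifiedCompletion F) =
    algebraMap 𝒪[F] (maxUnramifiedCompletion F) (u : 𝒪[F]) * (ε : maxUnramifiedCompletion F))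
variable (θ : CompletedAlgClosure F →+* ℂ_[2]) (hθc : Continuous θ)
  (hθ1 : ∀ z : CBall F, ‖θ (z : CompletedAlgClosure F)‖ ≤ 1)

include hθc hθ1 in
/-- ★★ **R219-INST₂-CORE (α) — THE `∘ϑ̄`-LINE INSTANCE AT THE WITNESS.**  For every relative norm-coherent unit
`β` and every point `z₀ ∈ 𝔪_ℂ` (the `σ a`-conjugate torsion point of `read₂_of_refl_cut`, read in `𝒪_ℂ`), the
reading witness `(L∘y)∘ϑ̄ ∈ 𝒪_ℂ⟦S⟧` of the NORMALISED reflection quotient `P_β` EXISTS and its `θ`-value at `z₀`,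
computed as the reading computes it (`Σ_m θ([S^m]·)·θ(z₀)^m`), IS `½·plog θ(P_β(ϑ̄(z₀)))`.
Assembly: producer §C (k3-g39's congruence ↦ J10's currency, normalised) ▸ J10 at the point `ϑ̄(z₀) ∈ 𝔪_ℂ`
▸ k3-g40's `tsum_coeff_map_subst_mul_pow_eq` (the `∘ϑ̄` line) ▸ tree `evS_subst`.  No hypothesis beyond the frame. -/
theorem inst₂_core_alpha (β : RelNormCoherentUnits (isUniformizer_unit_mul h2 u) E) (z₀ : (maxNilIdealC F).toIdeal) :
    ∃ L y : PowerSeries (CBall F), PowerSeries.constantCoeff y = 0 ∧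
      reflQuotN hq h2 u E hE hσ₀ β = 1 + PowerSeries.C (2 : CBall F) * y ∧
      θ ((PowerSeries.coeff 0 L : CBall F) : CompletedAlgClosure F) = 0 ∧
      ∑' m : ℕ, PowerSeries.coeff m (PowerSeries.map (θ.comp (CBall F).subtype)
          (PowerSeries.subst (thetaBar h2 u hσ₀ hε) (PowerSeries.subst y L))) *
          (θ ((z₀ : CBall F) : CompletedAlgClosure F)) ^ m =
        (2 : ℂ_[2])⁻¹ * PadicExp.plog
          (θ ((evS (maxNilIdealC F) z₀
            (PowerSeries.subst (thetaBar h2 u hσ₀ hε) (reflQuotN hq h2 u E hE hσ₀ β)) : CBall F) :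
              CompletedAlgClosure F)) := by
  obtain ⟨L, y, hy0, hPy, hL0, hval⟩ := inst₂_leaves_assembled θ hθc hθ1 (norm_two_lt_one_C h2)
    (reflQuotN hq h2 u E hE hσ₀ β) (constantCoeff_reflQuotN hq h2 u E hE hσ₀ β)
    (two_dvd_coeff_succ_reflQuotN hq h2 u E hE hσ₀ β)
    ⟨evS (maxNilIdealC F) z₀ (thetaBar h2 u hσ₀ hε),
      evS_mem_of_constantCoeff_eq_zero _ z₀ (constantCoeff_thetaBar h2 u hσ₀ hε)⟩
  refine ⟨L, y, hy0, hPy, hL0, ?_⟩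
  rw [ReadTwoCut.tsum_coeff_map_subst_mul_pow_eq θ hθc (PowerSeries.subst y L) (thetaBar h2 u hσ₀ hε)
      (constantCoeff_thetaBar h2 u hσ₀ hε) z₀,
    evS_subst (maxNilIdealC F) z₀ (constantCoeff_thetaBar h2 u hσ₀ hε)]
  exact hval

/-! ### §E  (β)-KEY: the gauge constant, and the identification with k3-g39's transport `V_β`. -/

/-- `P_β(ϑ̄(z₀)) = a_β⁻¹ · Q̄_β(ϑ̄(z₀))` in `𝒪_ℂ`. -/
theorem evS_subst_thetaBar_reflQuotN (β : RelNormCoherentUnits (isUniformizer_unit_mul h2 u) E)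
    (z₀ : (maxNilIdealC F).toIdeal) :
    evS (maxNilIdealC F) z₀ (PowerSeries.subst (thetaBar h2 u hσ₀ hε) (reflQuotN hq h2 u E hE hσ₀ β)) =
      (↑(gaugeUnit hq h2 u E hE hσ₀ β)⁻¹ : CBall F) *
        evS (maxNilIdealC F) z₀ (PowerSeries.subst (thetaBar h2 u hσ₀ hε) (reflQuotC hq h2 u E hE hσ₀ β)) := by
  rw [evS_subst (maxNilIdealC F) z₀ (constantCoeff_thetaBar h2 u hσ₀ hε),
    evS_subst (maxNilIdealC F) z₀ (constantCoeff_thetaBar h2 u hσ₀ hε), reflQuotN, map_mul, evS_C]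

/-- THE GAUGE CONSTANT of the reading: `c_β := −½·plog θ(a_β)` — INDEPENDENT of the evaluation point; it is what
`read₂_of_refl_cut`'s `c`-slot absorbs (critic (β), B67's «constant of integration invisible to χ₀ ≠ 1»). -/
def gaugeConst (β : RelNormCoherentUnits (isUniformizer_unit_mul h2 u) E) : ℂ_[2] :=
  -((2 : ℂ_[2])⁻¹ * PadicExp.plog (θ ((gaugeUnit hq h2 u E hE hσ₀ β : CBall F) : CompletedAlgClosure F)))

include hθ1 in
/-- `θ(a_β)` is a principal unit of `ℂ₂`. -/
theorem norm_one_sub_map_gaugeUnit_lt (β : RelNormCoherentUnits (isUniformizer_unit_mul h2 u) E) :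
    ‖1 - θ ((gaugeUnit hq h2 u E hE hσ₀ β : CBall F) : CompletedAlgClosure F)‖ < 1 :=
  norm_one_sub_map_lt_one_of_two_dvd θ hθ1 (two_dvd_constantCoeff_reflQuotC_sub_one hq h2 u E hE hσ₀ β)

include hθ1 in
/-- `θ(P_β(ϑ̄(z₀)))` is a principal unit of `ℂ₂`. -/
theorem norm_one_sub_map_evS_reflQuotN_lt (β : RelNormCoherentUnits (isUniformizer_unit_mul h2 u) E)
    (z₀ : (maxNilIdealC F).toIdeal) :
    ‖1 - θ ((evS (maxNilIdealC F) z₀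
      (PowerSeries.subst (thetaBar h2 u hσ₀ hε) (reflQuotN hq h2 u E hE hσ₀ β)) : CBall F) :
        CompletedAlgClosure F)‖ < 1 := by
  rw [evS_subst (maxNilIdealC F) z₀ (constantCoeff_thetaBar h2 u hσ₀ hε)]
  exact norm_one_sub_map_lt_one_of_two_dvd θ hθ1 (two_dvd_evS_sub_one
    (constantCoeff_reflQuotN hq h2 u E hE hσ₀ β) (two_dvd_coeff_succ_reflQuotN hq h2 u E hE hσ₀ β) _)

include hθ1 in
/-- ★ **(β)-KEY**: `½·plog θ(P_β(ϑ̄ z₀)) = ½·plog θ(Q̄_β(ϑ̄ z₀)) + c_β` — the normalisation costs exactly a constant.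
(`plog` is additive on principal units ONLY; both factors are principal by §B, `hθ1` alone.) -/
theorem half_plog_reflQuotN_eq (β : RelNormCoherentUnits (isUniformizer_unit_mul h2 u) E)
    (z₀ : (maxNilIdealC F).toIdeal) :
    (2 : ℂ_[2])⁻¹ * PadicExp.plog (θ ((evS (maxNilIdealC F) z₀
        (PowerSeries.subst (thetaBar h2 u hσ₀ hε) (reflQuotN hq h2 u E hE hσ₀ β)) : CBall F) :
          CompletedAlgClosure F)) =
      (2 : ℂ_[2])⁻¹ * PadicExp.plog (θ ((evS (maxNilIdealC F) z₀
        (PowerSeries.subst (thetaBar h2 u hσ₀ hε) (reflQuotC hq h2 u E hE hσ₀ β)) : CBall F) :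
          CompletedAlgClosure F)) + gaugeConst hq h2 u E hE hσ₀ θ β := by
  have hq' := norm_one_sub_map_evS_reflQuotN_lt hq h2 u E hE hσ₀ hε θ hθ1 β z₀
  have hr := norm_one_sub_map_gaugeUnit_lt hq h2 u E hE hσ₀ θ hθ1 β
  have hinv : θ (((↑(gaugeUnit hq h2 u E hE hσ₀ β)⁻¹ : CBall F)) : CompletedAlgClosure F) *
      θ ((gaugeUnit hq h2 u E hE hσ₀ β : CBall F) : CompletedAlgClosure F) = 1 := by
    rw [← map_mul, ← Subring.coe_mul, Units.inv_mul, Subring.coe_one, map_one]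
  have hmul : θ ((evS (maxNilIdealC F) z₀
        (PowerSeries.subst (thetaBar h2 u hσ₀ hε) (reflQuotN hq h2 u E hE hσ₀ β)) : CBall F) :
          CompletedAlgClosure F) *
      θ ((gaugeUnit hq h2 u E hE hσ₀ β : CBall F) : CompletedAlgClosure F) =
      θ ((evS (maxNilIdealC F) z₀
        (PowerSeries.subst (thetaBar h2 u hσ₀ hε) (reflQuotC hq h2 u E hE hσ₀ β)) : CBall F) :
          CompletedAlgClosure F) := by
    rw [evS_subst_thetaBar_reflQuotN, Subring.coe_mul, map_mul, mul_right_comm, hinv, one_mul]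
  rw [ReadTwoCut.plog_eq_sub_of_mul_eq hq' hr hmul, gaugeConst]
  ring

variable (j : unitBall E →+* UnrCoeff F) (hjC : (algebraMap (UnrCoeff F) (CBall F)).comp j = unitBallToCBall E)

include hjC in
/-- ★ **IDENTIFICATION WITH THE WITNESS OF RECORD**: `θ̄(Q̄_β ∘ ϑ̄) = transport (reflQuot β) = Θ(j(Q_β) ∘ ϑ)`
(k3-g39's `V_β`-carrier; tree `map_subst_compSeriesC_map_eq`, the only place `j`/`hjC` enter). -/
theorem map_subst_thetaBar_reflQuotC_eq_transport (β : RelNormCoherentUnits (isUniformizer_unit_mul h2 u) E) :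
    (PowerSeries.subst (thetaBar h2 u hσ₀ hε) (reflQuotC hq h2 u E hE hσ₀ β)).map (θ.comp (CBall F).subtype) =
      ReflectionPrimitive.transport h2 u E hσ₀ j hε θ
        (ReflectionPrimitive.reflQuot (isUniformizer_unit_mul h2 u) E hq hE hσ₀ β : PowerSeries (unitBall E)) :=
  (map_subst_compSeriesC_map_eq h2 u E hσ₀ j hε θ hjC _).symm

include hθc hjC in
/-- ★ the VALUE of the transported quotient at `z₀`, as the reading evaluates it, is `θ(Q̄_β(ϑ̄ z₀))`. -/
theorem transport_reflQuot_value (β : RelNormCoherentUnits (isUniformizer_unit_mul h2 u) E)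
    (z₀ : (maxNilIdealC F).toIdeal) :
    ∑' m : ℕ, PowerSeries.coeff m (ReflectionPrimitive.transport h2 u E hσ₀ j hε θ
        (ReflectionPrimitive.reflQuot (isUniformizer_unit_mul h2 u) E hq hE hσ₀ β : PowerSeries (unitBall E))) *
        (θ ((z₀ : CBall F) : CompletedAlgClosure F)) ^ m =
      θ ((evS (maxNilIdealC F) z₀
        (PowerSeries.subst (thetaBar h2 u hσ₀ hε) (reflQuotC hq h2 u E hE hσ₀ β)) : CBall F) :
          CompletedAlgClosure F) := by
  rw [← map_subst_thetaBar_reflQuotC_eq_transport hq h2 u E hE hσ₀ hε θ j hjC]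
  exact (hasSum_map_coeff_mul_pow θ hθc _ z₀).tsum_eq

include hθc hθ1 hjC in
/-- ★★ **(α) + (β)-KEY COMBINED, in the shape the reading consumes**: the reading witness of `P_β` along `ϑ̄`
evaluates at `z₀` to `½·plog (V_β-value at z₀) + c_β`, where the `V_β`-value is the evaluated TRANSPORT of record
and `c_β` does not depend on `z₀` (so it lands in `read₂_of_refl_cut`'s `c`). -/
theorem inst₂_core_alpha_beta (β : RelNormCoherentUnits (isUniformizer_unit_mul h2 u) E)
    (z₀ : (maxNilIdealC F).toIdeal) :
    ∃ L y : PowerSeries (CBall F), PowerSeries.constantCoeff y = 0 ∧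
      reflQuotN hq h2 u E hE hσ₀ β = 1 + PowerSeries.C (2 : CBall F) * y ∧
      θ ((PowerSeries.coeff 0 L : CBall F) : CompletedAlgClosure F) = 0 ∧
      ∑' m : ℕ, PowerSeries.coeff m (PowerSeries.map (θ.comp (CBall F).subtype)
          (PowerSeries.subst (thetaBar h2 u hσ₀ hε) (PowerSeries.subst y L))) *
          (θ ((z₀ : CBall F) : CompletedAlgClosure F)) ^ m =
        (2 : ℂ_[2])⁻¹ * PadicExp.plog
          (∑' m : ℕ, PowerSeries.coeff m (ReflectionPrimitive.transport h2 u E hσ₀ j hε θ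
            (ReflectionPrimitive.reflQuot (isUniformizer_unit_mul h2 u) E hq hE hσ₀ β :
              PowerSeries (unitBall E))) * (θ ((z₀ : CBall F) : CompletedAlgClosure F)) ^ m) +
          gaugeConst hq h2 u E hE hσ₀ θ β := by
  obtain ⟨L, y, hy0, hPy, hL0, hval⟩ := inst₂_core_alpha hq h2 u E hE hσ₀ hε θ hθc hθ1 β z₀
  refine ⟨L, y, hy0, hPy, hL0, ?_⟩
  rw [hval, half_plog_reflQuotN_eq hq h2 u E hE hσ₀ hε θ hθ1 β z₀,
    transport_reflQuot_value hq h2 u E hE hσ₀ hε θ hθc j hjC β z₀]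

/-! ### §F  The LOG-BRANCH remark for (β)/(δ) (new observation) and the quotient identity it needs. -/

/-- `Q_β · τ_E g_β = g_β` (units of `𝒪_E⟦X⟧`, k3-g39's definition unfolded). -/
theorem reflQuot_mul_reflE (β : RelNormCoherentUnits (isUniformizer_unit_mul h2 u) E) :
    (ReflectionPrimitive.reflQuot (isUniformizer_unit_mul h2 u) E hq hE hσ₀ β : PowerSeries (unitBall E)) *
        reflE (isUniformizer_unit_mul h2 u) E
          (ReflectionPrimitive.gUnit (isUniformizer_unit_mul h2 u) E hq hE hσ₀ β : PowerSeries (unitBall E)) =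
      (ReflectionPrimitive.gUnit (isUniformizer_unit_mul h2 u) E hq hE hσ₀ β : PowerSeries (unitBall E)) := by
  have h := congrArg Units.val (inv_mul_cancel_right
    (ReflectionPrimitive.gUnit (isUniformizer_unit_mul h2 u) E hq hE hσ₀ β)
    (reflEUnit (isUniformizer_unit_mul h2 u) E
      (ReflectionPrimitive.gUnit (isUniformizer_unit_mul h2 u) E hq hE hσ₀ β)))
  rw [Units.val_mul, coe_reflEUnit] at h
  exact h

omit [Normal F E] [IsGalois F E] in
/-- `τ_E` is `𝒪_E`-linear on constants: `τ_E (C a · G) = C a · τ_E G`. -/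
theorem reflE_C_mul (a : unitBall E) (G : PowerSeries (unitBall E)) :
    reflE (isUniformizer_unit_mul h2 u) E (PowerSeries.C a * G) =
      PowerSeries.C a * reflE (isUniformizer_unit_mul h2 u) E G := by
  rw [map_mul, reflE_C]

omit [Normal F E] [IsGalois F E] in
/-- ★ **LOG-BRANCH REMARK (β′)**: the reflection quotient is GAUGE-INVARIANT under `g ↦ C a · g` — so in the REFL
presentation `plog Q̄_β(w) = Lg a − Lg (a+s)` one may (and must) take `Lg` on the PRINCIPAL normalisation
`g_β/g_β(0)` (`g_β(w_a)` itself is a unit of `𝒪_ℂ` but NOT a principal unit when `[k_E : 𝔽₂] > 1`, and `plog` of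
record is the principal branch). -/
theorem quot_mul_reflE_rescale {Q G : PowerSeries (unitBall E)}
    (h : Q * reflE (isUniformizer_unit_mul h2 u) E G = G) (a : unitBall E) :
    Q * reflE (isUniformizer_unit_mul h2 u) E (PowerSeries.C a * G) = PowerSeries.C a * G := by
  rw [reflE_C_mul h2 u, mul_left_comm, h]

end Core

/-! ### §G  The REFL-table character sum instantiated at `Γ := (ℤ/2^{n+1})ˣ`, `γ₀ := 1 + 2^n` -/

section CharSum

open Literature.NumberTheory.LFunctions.TwoPowerConductor

/-- ★ **R219-INST₂'s «ONE application with `Γ := (ℤ/N)ˣ`», character bookkeeping discharged for ALL `n ≥ 1`:**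
for `N = 2^{n+1}` and ANY table `T` on `(ℤ/N)ˣ`, the REFL-table character sum against a character not factoring
through `2^n` is `2κ·` the plain one — `ShiftLift.refl_table_charSum` with `e := refl`, `γ₀ := 1 + 2^n`, both of
its hypotheses (`hγ₀`, `hψ`) THEOREMS (Literature `gammaZero_mul_self`, `apply_gammaZero_eq_neg_one`). -/
theorem refl_table_charSum_two_pow {R : Type*} [CommRing R] [IsDomain R] {n : ℕ} (hn : 1 ≤ n)
    (χ : DirichletCharacter R (2 ^ (n + 1))) (hχ : ¬χ.FactorsThrough (2 ^ n))
    (T : (ZMod (2 ^ (n + 1)))ˣ → R) (κ : R) :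
    ∑ γ : (ZMod (2 ^ (n + 1)))ˣ, χ (γ : ZMod (2 ^ (n + 1))) * (κ * (T γ - T (γ * gammaZero hn))) =
      2 * κ * ∑ γ : (ZMod (2 ^ (n + 1)))ˣ, χ (γ : ZMod (2 ^ (n + 1))) * T γ :=
  ShiftLift.refl_table_charSum (MulEquiv.refl _) χ T κ (gammaZero hn) (gammaZero_mul_self hn)
    (apply_gammaZero_eq_neg_one hn χ hχ)

end CharSum

end Summit.BirchSwinnertonDyer.Rank1Residual.P2.InstTwoCore

end
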